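import Literature.NumberTheory.LFunctions.ThetaChainFreeCheck
import HarnessLib

/-!
# Schoenfeld's `θ`-bound on `[599, 10⁸]` by kernel computation: data-free run, chunk 5 of 35

Topic: `Literature/NumberTheory/LFunctions`. Pure proof file (a kernel computation; nothing is
asserted, no definition). The theorems below evaluate `ThetaChain.runFree` — together `150000`
data-free steps of the certified `θ`-chain (`ThetaChain.stepFree`, `ThetaChainFreeCheck.lean`: the
next prime found and certified by two gcds with the primorials of the odd primes `≤ 2999` and in
`(2999, 10007]`, the enclosures of `log p` and `θ(p)`, and the two comparisons behind
`|θ(x) − x| ≤ √x log² x/(8π)`) — from the state at the prime `18736847` to the state at the prime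
`21260413`. Soundness: `ThetaChain.runFree_sound`; assembly of the 35 chunks: `ThetaUpTo1e8.lean`.
The expected states were obtained by evaluating a twin of the same function outside the kernel
(validated bit-for-bit on the tree's chunk `ThetaChainRun.xrun14`). Declarations of `5·10⁴` steps
(about `70 s` of kernel time each; the kernel's evaluation is linear within a declaration of this size),
`decide +kernel`, standard axioms only (`maxHeartbeats 0` lifts the deterministic time-out).

## References

* L. Schoenfeld, *Sharper bounds for the Chebyshev functions θ(x) and ψ(x). II*, Math. Comp. 30
  (1976), 337–360, Thm. 10 (6.3). [Schoenfeld1976]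
* J. B. Rosser, L. Schoenfeld, *Approximate formulas for some functions of prime numbers*,
  Illinois J. Math. 6 (1962), 64–94, Thms. 18–19 (`θ`-tables to `10⁸`). [RosserSchoenfeld1962]
-/

namespace Literature.NumberTheory.LFunctions.ThetaChainRun

open ThetaChain

set_option maxHeartbeats 0 in
/-- **Data-free certified `θ`-run, chunk 5a** (steps `600001`–`650000` after `8886113`: 50000 primes,
`18736847` to `19576643`). [cite: Schoenfeld1976, Thm. 10 (6.3)] -/
theorem frun5a :
    runFree 50000
      ⟨18736847, 20244674883276548624741535, 20244674883277024256962772, 22646772362366377849176762043257, 22646772362366946376345916849016⟩ =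
    some ⟨19576643, 20297680428083221311672950, 20297680428083696944894902, 23660339381633413636379267169856, 23660339381634005945184525397970⟩ := by
  decide +kernel

set_option maxHeartbeats 0 in
/-- **Data-free certified `θ`-run, chunk 5b** (steps `650001`–`700000` after `8886113`: 50000 primes,
`19576643` to `20417149`). [cite: Schoenfeld1976, Thm. 10 (6.3)] -/
theorem frun5b :
    runFree 50000
      ⟨19576643, 20297680428083221311672950, 20297680428083696944894902, 23660339381633413636379267169856, 23660339381634005945184525397970⟩ =
    some ⟨20417149, 20348501267433312363093666, 20348501267433787997313033, 24676500210395368930168460465351, 24676500210395985020659747747640⟩ := by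
  decide +kernel

set_option maxHeartbeats 0 in
/-- **Data-free certified `θ`-run, chunk 5c** (steps `700001`–`750000` after `8886113`: 50000 primes,
`20417149` to `21260413`). [cite: Schoenfeld1976, Thm. 10 (6.3)] -/
theorem frun5c :
    runFree 50000
      ⟨20417149, 20348501267433312363093666, 20348501267433787997313033, 24676500210395368930168460465351, 24676500210395985020659747747640⟩ =
    some ⟨21260413, 20397428446450642465472225, 20397428446451118100685807, 25695154664245769872348650592457, 25695154664246409744575789925186⟩ := by
  decide +kernel

end Literature.NumberTheory.LFunctions.ThetaChainRun
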